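import Mathlib
import Literature.Geometry.DiscreteGeometry.KissingFanTriangleSets
import Literature.Geometry.DiscreteGeometry.SphericalCodeHullVertexLink
import Summits.AtomisticToContinuum.Crystallization.Theorems.GappedShellCensusShellTrichotomyStubBondHullEdge
import Summits.AtomisticToContinuum.Crystallization.Theorems.GappedShellCensusShellTrichotomyStubBondTriangleFacet
import Summits.AtomisticToContinuum.Crystallization.Theorems.GappedShellCensusFiveFoldRationingRStubFfrCensus5Aux1

/-!
# Crux `GappedShellCensus.FiveFoldRationingR` (stmt-AtomisticToContinuum-18071), line `Sketch` —
# helper for stub `stub_ffrC5Dict` (Aux1 = registered sub-goal `stub_ffrC5QCornerMin`): the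
# Q-corner lower bound, and the transport of the fan machinery along the labelling

Two groups of bricks for the dictionary `stub_ffrC5Dict` (gapped twelve-tuple with all
shell-degrees `≥ 4` ↦ labelled fan data with corner bounds).

* **The Q-corner lower bound** (`stub_ffrC5QCornerMin`, registered sub-goal).  Let
  `v d a : ℝ³` have norms in `[0.98, 1.02]`, let `vd` and `va` be bonds (distance in
  `[0.98, 1.02]`) and let `da` be far (`dist d a ≥ 1.26`).  Then the dihedral angle about the
  spoke `0v` between the half-planes through `d` and through `a` — the angle between the
  components `perpTo v d`, `perpTo v a` of `d`, `a` orthogonal to `v` — is at least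
  `arccos (1/25) ≈ 87.71°` (true infimum `≈ 87.83°`).  Proof on the unit sphere
  (`ffrC5D_qCornerMin_unit`): with `x = ⟪v̂, d̂⟫`, `y = ⟪v̂, â⟫ ∈ [2201/4802, 2801/5202]` and
  `z = ⟪d̂, â⟫ ≤ 1233/5202` the dihedral cosine is `(z − xy)/√((1 − x²)(1 − y²))`
  (`inner_perpTo_perpTo_of_norm_eq_one`, `norm_perpTo_sq_of_norm_eq_one`), and
  `z − xy ≤ 1233/5202 − (2201/4802)² ≈ 0.0269` while `(1 − x²)(1 − y²) ≥ (1 − (2801/5202)²)²`,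
  whence the cosine is `≤ 0.0380 < 1/25`; the dihedral angle is invariant under positive
  rescaling of the three points (`ffrC5D_angle_perpTo_smul`), which transports the bound to
  the original points.
* **Transport along the labelling** (`ffrC5D_*`, adapted from the sibling crux's
  `GappedShellCensusShellTrichotomyStubFanStruct`, where they are private): for an injective
  labelling `u : Fin 12 → X` of a finite set of unit vectors and the label triples `tri`
  with `S ∈ tri ↔ u '' S ∈ fanTriSets X`, the tree's `card_eq_three_of_mem_fanTriSets`,
  `card_fanTriSets`, `card_filter_fanTriSets_eq_two`,
  `card_filter_fanTriSets_eq_two_of_mem_hullEdges` (with `stub_bondHullEdge`),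
  `stub_bondTriangleFacet` and `fanTriSets_link` in label form.
-/

noncomputable section

namespace Summit.AtomisticToContinuum.Crystallization.Theorems

open scoped RealInnerProductSpace
open Literature.Geometry.DiscreteGeometry InnerProductGeometry

/-! ### Scaling invariance of the dihedral angle -/

/-- `perpTo` is `0`-homogeneous in its first argument. [folklore] -/
theorem ffrC5D_perpTo_smul_left (p q : EuclideanSpace ℝ (Fin 3)) {c : ℝ} (hc : c ≠ 0) :
    perpTo (c • p) q = perpTo p q := by
  -- adapted from `perpTo_smul_left` of the sibling crux's
  -- `GappedShellCensusShellTrichotomyStubFanAngles.lean` (private there)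
  rw [perpTo_def, perpTo_def, real_inner_smul_left, real_inner_smul_left, real_inner_smul_right,
    smul_smul]
  rcases eq_or_ne p 0 with rfl | hp
  · simp
  · have hpp : ⟪p, p⟫ ≠ 0 := fun h => hp (inner_self_eq_zero.1 h)
    congr 2
    field_simp

/-- The dihedral angle about the spoke `0p` between `q` and `r` is invariant under rescaling the
three points by nonzero resp. positive factors. [folklore] -/
theorem ffrC5D_angle_perpTo_smul (p q r : EuclideanSpace ℝ (Fin 3)) {α β γ : ℝ} (hα : α ≠ 0)
    (hβ : 0 < β) (hγ : 0 < γ) :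
    angle (perpTo (α • p) (β • q)) (perpTo (α • p) (γ • r)) = angle (perpTo p q) (perpTo p r) := by
  -- adapted from `angle_perpTo_smul` (sibling crux, `…StubFanAngles.lean`, private there)
  rw [ffrC5D_perpTo_smul_left p _ hα, ffrC5D_perpTo_smul_left p _ hα, perpTo_smul_right,
    perpTo_smul_right, angle_smul_left_of_pos _ _ hβ, angle_smul_right_of_pos _ _ hγ]

/-! ### The Q-corner lower bound -/

/-- Two FAR shell points (distance `≥ 1.26`) subtend an angle with cosine `≤ 1233/5202` (the
value for radii `1.02, 1.02` and distance `1.26`). [folklore] -/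
theorem ffrC5D_inner_normalize_far {a c : EuclideanSpace ℝ (Fin 3)}
    (ha : 1 - 1 / 50 ≤ ‖a‖ ∧ ‖a‖ ≤ 1 + 1 / 50) (hc : 1 - 1 / 50 ≤ ‖c‖ ∧ ‖c‖ ≤ 1 + 1 / 50)
    (hd : 63 / 50 ≤ dist a c) : ⟪‖a‖⁻¹ • a, ‖c‖⁻¹ • c⟫ ≤ 1233 / 5202 := by
  have ha0 : 0 < ‖a‖ := by linarith [ha.1]
  have hc0 : 0 < ‖c‖ := by linarith [hc.1]
  rw [ffrC5_inner_normalize a c ha0 hc0, div_le_iff₀ (mul_pos ha0 hc0)]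
  have h := norm_sub_sq_real a c
  rw [← dist_eq_norm] at h
  have hd2 : (63 / 50 : ℝ) ^ 2 ≤ dist a c ^ 2 := pow_le_pow_left₀ (by norm_num) hd 2
  nlinarith [mul_nonneg (sub_nonneg.2 ha.2) (sub_nonneg.2 hc.2),
    mul_nonneg (sub_nonneg.2 ha.1) (sub_nonneg.2 ha.2),
    mul_nonneg (sub_nonneg.2 hc.1) (sub_nonneg.2 hc.2)]

/-- The real-variable heart of the Q-corner bound: for `x, y ∈ [2201/4802, 2801/5202]`,
`z ≤ 1233/5202` and `z − xy > 0` one has `(z − xy)² ≤ (1/25)² (1 − x²)(1 − y²)`. [folklore] -/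
theorem ffrC5D_qCornerMin_key {x y z : ℝ} (hx : 2201 / 4802 ≤ x) (hx' : x ≤ 2801 / 5202)
    (hy : 2201 / 4802 ≤ y) (hy' : y ≤ 2801 / 5202) (hz : z ≤ 1233 / 5202) (hpos : 0 < z - x * y) :
    (z - x * y) ^ 2 ≤ (1 / 25) ^ 2 * ((1 - x ^ 2) * (1 - y ^ 2)) := by
  have hxy : (2201 / 4802 : ℝ) * (2201 / 4802) ≤ x * y :=
    mul_le_mul hx hy (by norm_num) (by linarith)
  have hN : z - x * y ≤ 1233 / 5202 - 2201 / 4802 * (2201 / 4802) := by linarith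
  have hN2 : (z - x * y) ^ 2 ≤ (1233 / 5202 - 2201 / 4802 * (2201 / 4802) : ℝ) ^ 2 :=
    pow_le_pow_left₀ hpos.le hN 2
  have hx2 : x ^ 2 ≤ (2801 / 5202 : ℝ) ^ 2 := pow_le_pow_left₀ (by linarith) hx' 2
  have hy2 : y ^ 2 ≤ (2801 / 5202 : ℝ) ^ 2 := pow_le_pow_left₀ (by linarith) hy' 2
  have hD : (1 - (2801 / 5202 : ℝ) ^ 2) * (1 - (2801 / 5202) ^ 2) ≤ (1 - x ^ 2) * (1 - y ^ 2) :=
    mul_le_mul (by linarith) (by linarith) (by norm_num) (by linarith)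
  nlinarith [hN2, hD]

/-- **Q-corner lower bound on the unit sphere.**  For unit vectors `v, d, a` with
`⟪v, d⟫, ⟪v, a⟫ ∈ [2201/4802, 2801/5202]` and `⟪d, a⟫ ≤ 1233/5202` the dihedral angle
`∠(perpTo v d, perpTo v a)` is at least `arccos (1/25)`. [folklore] -/
theorem ffrC5D_qCornerMin_unit {v d a : EuclideanSpace ℝ (Fin 3)} (hv : ‖v‖ = 1) (hd : ‖d‖ = 1)
    (ha : ‖a‖ = 1)
    (hvd : 2201 / 4802 ≤ ⟪v, d⟫ ∧ ⟪v, d⟫ ≤ 2801 / 5202)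
    (hva : 2201 / 4802 ≤ ⟪v, a⟫ ∧ ⟪v, a⟫ ≤ 2801 / 5202) (hda : ⟪d, a⟫ ≤ 1233 / 5202) :
    Real.arccos (1 / 25) ≤ angle (perpTo v d) (perpTo v a) := by
  have hpq : ⟪perpTo v d, perpTo v a⟫ = ⟪d, a⟫ - ⟪v, d⟫ * ⟪v, a⟫ :=
    inner_perpTo_perpTo_of_norm_eq_one hv d a
  have hp2 : ‖perpTo v d‖ ^ 2 = 1 - ⟪v, d⟫ ^ 2 := norm_perpTo_sq_of_norm_eq_one hv hd
  have hq2 : ‖perpTo v a‖ ^ 2 = 1 - ⟪v, a⟫ ^ 2 := norm_perpTo_sq_of_norm_eq_one hv ha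
  have hx2 : ⟪v, d⟫ ^ 2 < 1 := by nlinarith [hvd.1, hvd.2]
  have hy2 : ⟪v, a⟫ ^ 2 < 1 := by nlinarith [hva.1, hva.2]
  have hp0 : 0 < ‖perpTo v d‖ :=
    lt_of_pow_lt_pow_left₀ 2 (norm_nonneg _) (by rw [hp2]; linarith)
  have hq0 : 0 < ‖perpTo v a‖ :=
    lt_of_pow_lt_pow_left₀ 2 (norm_nonneg _) (by rw [hq2]; linarith)
  unfold angle
  refine Real.arccos_le_arccos ((div_le_iff₀ (mul_pos hp0 hq0)).2 ?_)
  rcases le_or_gt ⟪perpTo v d, perpTo v a⟫ 0 with hle | hlt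
  · exact hle.trans (by positivity)
  · refine le_of_pow_le_pow_left₀ two_ne_zero (by positivity) ?_
    rw [mul_pow, mul_pow, hp2, hq2, hpq]
    rw [hpq] at hlt
    exact ffrC5D_qCornerMin_key hvd.1 hvd.2 hva.1 hva.2 hda hlt

/-- **Q-corner lower bound (registered sub-goal `stub_ffrC5QCornerMin` of `stub_ffrC5Dict`).**
About the spoke `0v` of a gapped shell, the dihedral angle between two bonded neighbours `d`, `a`
of `v` which are far from each other (`dist d a ≥ 1.26`) is at least `arccos (1/25) ≈ 87.71°`:
normalise the three points (the dihedral angle is scale invariant, `ffrC5D_angle_perpTo_smul`)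
and apply `ffrC5D_qCornerMin_unit` on the cosine windows of the gapped shell. [folklore] -/
theorem stub_ffrC5QCornerMin (v d a : EuclideanSpace ℝ (Fin 3))
    (hv : 1 - 1 / 50 ≤ ‖v‖ ∧ ‖v‖ ≤ 1 + 1 / 50) (hd : 1 - 1 / 50 ≤ ‖d‖ ∧ ‖d‖ ≤ 1 + 1 / 50)
    (ha : 1 - 1 / 50 ≤ ‖a‖ ∧ ‖a‖ ≤ 1 + 1 / 50)
    (hvd : 1 - 1 / 50 ≤ dist v d ∧ dist v d ≤ 1 + 1 / 50)
    (hva : 1 - 1 / 50 ≤ dist v a ∧ dist v a ≤ 1 + 1 / 50) (hda : 63 / 50 ≤ dist d a) :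
    Real.arccos (1 / 25) ≤ InnerProductGeometry.angle (perpTo v d) (perpTo v a) := by
  have hv0 : 0 < ‖v‖ := by linarith [hv.1]
  have hd0 : 0 < ‖d‖ := by linarith [hd.1]
  have ha0 : 0 < ‖a‖ := by linarith [ha.1]
  have key := ffrC5D_qCornerMin_unit (ffrC5_norm_normalize hv) (ffrC5_norm_normalize hd)
    (ffrC5_norm_normalize ha)
    ⟨ffrC5_le_inner_normalize hv hd hvd.2, ffrC5_inner_normalize_le hv hd hvd.1⟩
    ⟨ffrC5_le_inner_normalize hv ha hva.2, ffrC5_inner_normalize_le hv ha hva.1⟩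
    (ffrC5D_inner_normalize_far hd ha hda)
  rwa [ffrC5D_angle_perpTo_smul v d a (inv_pos.2 hv0).ne' (inv_pos.2 hd0) (inv_pos.2 ha0)] at key

/-! ### Transport of the fan machinery along the labelling -/

section Transport

variable {u : Fin 12 → EuclideanSpace ℝ (Fin 3)} {X : Finset (EuclideanSpace ℝ (Fin 3))}
  {tri : Finset (Finset (Fin 12))}

/-- The labelled points are points of `X`. [folklore] -/
theorem ffrC5D_apply_mem (hX : X = Finset.univ.image u) (k : Fin 12) : u k ∈ X := by
  -- this section is adapted from the (private) transport section of the sibling crux's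
  -- `GappedShellCensusShellTrichotomyStubFanStruct.lean`
  rw [hX]
  exact Finset.mem_image_of_mem u (Finset.mem_univ k)

/-- `X` consists of unit vectors. [folklore] -/
theorem ffrC5D_norm_eq_one_of_mem (hu1 : ∀ k, ‖u k‖ = 1) (hX : X = Finset.univ.image u) :
    ∀ y ∈ X, ‖y‖ = 1 := by
  subst hX
  intro y hy
  obtain ⟨k, -, rfl⟩ := Finset.mem_image.1 hy
  exact hu1 k

/-- Distinct points of `X` have inner product `≤ 2801/5202`. [folklore] -/
theorem ffrC5D_inner_le_of_mem (hhi : ∀ k l, k ≠ l → ⟪u k, u l⟫ ≤ 2801 / 5202)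
    (hX : X = Finset.univ.image u) : ∀ y ∈ X, ∀ y' ∈ X, y ≠ y' → ⟪y, y'⟫ ≤ 2801 / 5202 := by
  subst hX
  intro y hy y' hy' hne
  obtain ⟨k, -, rfl⟩ := Finset.mem_image.1 hy
  obtain ⟨l, -, rfl⟩ := Finset.mem_image.1 hy'
  exact hhi k l fun h => hne (congrArg u h)

/-- A fan triangle of `X` is the image of a label triple of `tri`. [folklore] -/
theorem ffrC5D_exists_image_eq_of_mem (hX1 : ∀ y ∈ X, ‖y‖ = 1) (hX : X = Finset.univ.image u)
    (htri : ∀ S, S ∈ tri ↔ S.image u ∈ fanTriSets X) {T : Finset (EuclideanSpace ℝ (Fin 3))}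
    (hT : T ∈ fanTriSets X) : ∃ S ∈ tri, S.image u = T := by
  have hTX : T ⊆ Finset.univ.image u := hX ▸ subset_of_mem_fanTriSets hX1 hT
  obtain ⟨S, rfl⟩ := Finset.subset_univ_image_iff.1 hTX
  exact ⟨S, (htri S).2 hT, rfl⟩

/-- `S ↦ S.image u` maps `tri` onto `fanTriSets X`. [folklore] -/
theorem ffrC5D_image_tri (hX1 : ∀ y ∈ X, ‖y‖ = 1) (hX : X = Finset.univ.image u)
    (htri : ∀ S, S ∈ tri ↔ S.image u ∈ fanTriSets X) :
    tri.image (Finset.image u) = fanTriSets X := by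
  ext T
  rw [Finset.mem_image]
  constructor
  · rintro ⟨S, hS, rfl⟩
    exact (htri S).1 hS
  · intro hT
    obtain ⟨S, hS, rfl⟩ := ffrC5D_exists_image_eq_of_mem hX1 hX htri hT
    exact ⟨S, hS, rfl⟩

/-- Counting the triples through a label set `s` is counting the fan triangles through
`s.image u`. [folklore] -/
theorem ffrC5D_card_filter_tri (hu : Function.Injective u) (hX1 : ∀ y ∈ X, ‖y‖ = 1)
    (hX : X = Finset.univ.image u) (htri : ∀ S, S ∈ tri ↔ S.image u ∈ fanTriSets X)
    (s : Finset (Fin 12)) :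
    (tri.filter fun S' => s ⊆ S').card =
      ((fanTriSets X).filter fun T => s.image u ⊆ T).card := by
  rw [← Finset.card_image_of_injective (tri.filter fun S' => s ⊆ S') (Finset.image_injective hu)]
  congr 1
  ext T
  simp only [Finset.mem_image, Finset.mem_filter]
  constructor
  · rintro ⟨S, ⟨hS, hsS⟩, rfl⟩
    exact ⟨(htri S).1 hS, Finset.image_subset_image hsS⟩
  · rintro ⟨hT, hsT⟩
    obtain ⟨S, hS, rfl⟩ := ffrC5D_exists_image_eq_of_mem hX1 hX htri hT
    exact ⟨S, ⟨hS, (Finset.image_subset_image_iff hu).1 hsT⟩, rfl⟩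

/-- Field 1: every triple has three labels. [folklore] -/
theorem ffrC5D_card_eq_three_of_mem_tri (hu : Function.Injective u) (hX1 : ∀ y ∈ X, ‖y‖ = 1)
    (htri : ∀ S, S ∈ tri ↔ S.image u ∈ fanTriSets X) : ∀ S ∈ tri, S.card = 3 := by
  intro S hS
  rw [← Finset.card_image_of_injective S hu]
  exact card_eq_three_of_mem_fanTriSets hX1 ((htri S).1 hS)

/-- Field 2: twenty triples. [folklore] -/
theorem ffrC5D_card_tri (hu : Function.Injective u) (hX1 : ∀ y ∈ X, ‖y‖ = 1)
    (hX : X = Finset.univ.image u) (htri : ∀ S, S ∈ tri ↔ S.image u ∈ fanTriSets X)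
    (h0 : (0 : EuclideanSpace ℝ (Fin 3)) ∈
      interior (convexHull ℝ (X : Set (EuclideanSpace ℝ (Fin 3))))) :
    tri.card = 20 := by
  have h12 : X.card = 12 := by
    rw [hX, Finset.card_image_of_injective _ hu, Finset.card_univ, Fintype.card_fin]
  rw [← Finset.card_image_of_injective tri (Finset.image_injective hu),
    ffrC5D_image_tri hX1 hX htri]
  exact card_fanTriSets h12 hX1 h0

/-- Field 3: every side of a triple lies in exactly two triples. [folklore] -/
theorem ffrC5D_card_filter_side (hu : Function.Injective u) (hX1 : ∀ y ∈ X, ‖y‖ = 1)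
    (hX : X = Finset.univ.image u) (htri : ∀ S, S ∈ tri ↔ S.image u ∈ fanTriSets X)
    (h0 : (0 : EuclideanSpace ℝ (Fin 3)) ∈
      interior (convexHull ℝ (X : Set (EuclideanSpace ℝ (Fin 3))))) :
    ∀ S ∈ tri, ∀ s ⊆ S, s.card = 2 → (tri.filter fun S' => s ⊆ S').card = 2 := by
  intro S hS s hs h2
  rw [ffrC5D_card_filter_tri hu hX1 hX htri s]
  exact card_filter_fanTriSets_eq_two hX1 h0 ((htri S).1 hS) (Finset.image_subset_image hs)
    (by rw [Finset.card_image_of_injective s hu, h2])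

/-- Field 4: a bond (cosine `≥ 2201/4802`) is a side of exactly two triples
(`stub_bondHullEdge`). [folklore] -/
theorem ffrC5D_card_filter_bond (hu : Function.Injective u) (hX1 : ∀ y ∈ X, ‖y‖ = 1)
    (hX : X = Finset.univ.image u) (htri : ∀ S, S ∈ tri ↔ S.image u ∈ fanTriSets X)
    (h0 : (0 : EuclideanSpace ℝ (Fin 3)) ∈
      interior (convexHull ℝ (X : Set (EuclideanSpace ℝ (Fin 3)))))
    (hhi : ∀ k l, k ≠ l → ⟪u k, u l⟫ ≤ 2801 / 5202) {v w : Fin 12} (hvw : v ≠ w)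
    (hb : 2201 / 4802 ≤ ⟪u v, u w⟫) :
    (tri.filter fun S' => ({v, w} : Finset (Fin 12)) ⊆ S').card = 2 := by
  rw [ffrC5D_card_filter_tri hu hX1 hX htri, Finset.image_insert, Finset.image_singleton]
  refine card_filter_fanTriSets_eq_two_of_mem_hullEdges hX1 h0
    (stub_bondHullEdge X hX1 (u v) (u w) (ffrC5D_apply_mem hX v) (ffrC5D_apply_mem hX w)
      (hu.ne hvw) (by linarith) ?_)
  intro y hy hyv hyw
  rw [hX] at hy
  obtain ⟨m, -, rfl⟩ := Finset.mem_image.1 hy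
  have h1 := hhi v m fun h => hyv (congrArg u h).symm
  have h2 := hhi w m fun h => hyw (congrArg u h).symm
  linarith

/-- Field 5: a bonded triangle is a triple (`stub_bondTriangleFacet`: it is exactly the tight
set of a facet, hence the vertex set of the fan triangle `(c₀, 0)` of that facet). [folklore] -/
theorem ffrC5D_triple_mem_tri (hu : Function.Injective u) (hX1 : ∀ y ∈ X, ‖y‖ = 1)
    (hX : X = Finset.univ.image u) (htri : ∀ S, S ∈ tri ↔ S.image u ∈ fanTriSets X)
    (hhi : ∀ k l, k ≠ l → ⟪u k, u l⟫ ≤ 2801 / 5202) {a b c : Fin 12} (hab : a ≠ b)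
    (hbc : b ≠ c) (hac : a ≠ c) (kab : 2201 / 4802 ≤ ⟪u a, u b⟫)
    (kbc : 2201 / 4802 ≤ ⟪u b, u c⟫) (kac : 2201 / 4802 ≤ ⟪u a, u c⟫) :
    ({a, b, c} : Finset (Fin 12)) ∈ tri := by
  obtain ⟨c₀, hc₀, htight⟩ := stub_bondTriangleFacet X hX1 (ffrC5D_inner_le_of_mem hhi hX) (u a)
    (u b) (u c) (ffrC5D_apply_mem hX a) (ffrC5D_apply_mem hX b) (ffrC5D_apply_mem hX c)
    (hu.ne hab) (hu.ne hbc) (hu.ne hac) kab kbc kac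
  have himg : ({a, b, c} : Finset (Fin 12)).image u = {u a, u b, u c} := by
    rw [Finset.image_insert, Finset.image_insert, Finset.image_singleton]
  have h3 : (tightSet X c₀).card = 3 := by
    rw [htight, ← himg, Finset.card_image_of_injective _ hu]
    exact Finset.card_eq_three.2 ⟨a, b, c, hab, hac, hbc, rfl⟩
  have hp : (c₀, 0) ∈ fanTriangles X :=
    mem_fanTriangles.2 ⟨hc₀, by change 0 + 2 < (tightSet X c₀).card; omega⟩
  have heq : fanVerts X (c₀, 0) = tightSet X c₀ :=
    Finset.eq_of_subset_of_card_le (fanVerts_subset_tightSet hX1 hp)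
      (h3.trans (fanVerts_card hX1 hp).symm).le
  rw [htri, himg, ← htight]
  exact mem_fanTriSets.2 ⟨(c₀, 0), hp, heq⟩

/-- Field 6: the link of a label is connected (closure form), from `fanTriSets_link`.
[folklore] -/
theorem ffrC5D_link_tri (hu : Function.Injective u) (hX1 : ∀ y ∈ X, ‖y‖ = 1)
    (hX : X = Finset.univ.image u) (htri : ∀ S, S ∈ tri ↔ S.image u ∈ fanTriSets X)
    (h0 : (0 : EuclideanSpace ℝ (Fin 3)) ∈
      interior (convexHull ℝ (X : Set (EuclideanSpace ℝ (Fin 3)))))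
    (v : Fin 12) (A : Finset (Finset (Fin 12))) (hA : A ⊆ tri.filter fun S => v ∈ S)
    (hne : A.Nonempty)
    (hcl : ∀ S ∈ A, ∀ S' ∈ tri, v ∈ S' → (S ∩ S').card = 2 → S' ∈ A) :
    A = tri.filter fun S => v ∈ S := by
  have key : A.image (Finset.image u) = (fanTriSets X).filter fun T => u v ∈ T := by
    refine fanTriSets_link hX1 h0 ?_ (hne.image _) ?_
    · intro T hT
      obtain ⟨S, hS, rfl⟩ := Finset.mem_image.1 hT
      obtain ⟨hS1, hS2⟩ := Finset.mem_filter.1 (hA hS)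
      exact Finset.mem_filter.2 ⟨(htri S).1 hS1, hu.mem_finset_image.2 hS2⟩
    · intro T hT T' hT' hvT' h2
      obtain ⟨S, hS, rfl⟩ := Finset.mem_image.1 hT
      obtain ⟨S', hS', rfl⟩ := ffrC5D_exists_image_eq_of_mem hX1 hX htri hT'
      rw [← Finset.image_inter _ _ hu, Finset.card_image_of_injective _ hu] at h2
      exact Finset.mem_image_of_mem _ (hcl S hS S' hS' (hu.mem_finset_image.1 hvT') h2)
  refine Finset.Subset.antisymm hA fun S hS => ?_
  obtain ⟨hS1, hS2⟩ := Finset.mem_filter.1 hS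
  have hSA : S.image u ∈ A.image (Finset.image u) := by
    rw [key]
    exact Finset.mem_filter.2 ⟨(htri S).1 hS1, hu.mem_finset_image.2 hS2⟩
  obtain ⟨S₀, hS₀, he⟩ := Finset.mem_image.1 hSA
  exact Finset.image_injective hu he ▸ hS₀

end Transport

end Summit.AtomisticToContinuum.Crystallization.Theorems

end
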